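import Literature.ModelTheory.Zilber.EACTorusScalings
import Literature.ModelTheory.Zilber.EACProofs
import Summits.Schanuel.Schanuel.Theorems.ZilberEacTorusRuledDense
import HarnessLib

/-!
# Torus-ruled varieties meet the graph of `exp` — a structural sub-rung of `EC(n, n-1)`

Zilber's Exponential-Algebraic Closedness, case ladder (host summit Schanuel, cell `pub-schanuel`,
seat 2, gen 4).  Let `W ⊆ ℂⁿ × ℂⁿ` be irreducible Zariski closed, `V = W ∩ Gⁿ ≠ ∅` additively free,
and suppose `V` is **torus-ruled in the lattice direction `ν ∈ ℤⁿ ∖ 0`**: with every point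
`(x, y)` it contains the coset `(x, y · t^ν)`, `t ∈ ℂˣ` (`IsTorusStable ν V`; e.g. proportional
fibres `y₁/A₁(x) = y₂/A₂(x) = y₃/A₃(x)`, or any family of fibre curves `yᵢ = cᵢ(x) t^{νᵢ}` with
algebraic coefficients).  Such `V` is never "perfectly rotund" (`dim [M]V = rk M` for `M` a basis
of `ν^⊥`), so it lies in the stratum where Zilber's rotundity condition is tight.

* **Theorem A** (`inter_expGraph_nonempty_of_isTorusStable`, any `n`). If moreover `π(V) + ℂ·ν`
  is Zariski dense in `ℂⁿ` (`DenseModDir`), then `W ∩ Γ_exp ≠ ∅`.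
  Proof: complete the primitive part of `ν` to a basis of `ℤⁿ` (`EACLatticeLemmas`); under the
  lattice change `Φ_U (x, y) = (U x, y^U)` with `U ν = g eᵢ` (`EACMonomialChange`; every property
  and the conclusion are invariant) the closure `W^U` is a CYLINDER in `yᵢ` (`EACTorusScalings`),
  and `π(V) + ℂ ν` dense becomes `π(V^U) + ℂ eᵢ` dense; conclude by the swap trick
  `xᵢ ↔ yᵢ` + Aslanyan–Kirby–Mantova Thm. 1.5 (`inter_expGraph_nonempty_of_cylinder_of_off`,
  `EACPeriodicCylinders`).
* **Theorem B** (`…_of_not_isPeriodVec`, cells `(d+1, d)`): for a hypersurface base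
  (`addProjDim = d`) the density hypothesis holds as soon as `ν` is not a period vector of the base
  (`ZilberEacTorusRuledDense`).  Hence (`…_of_not_hasIntegerPeriod`,
  `ecCellAperiodic_of_isTorusStable`): **in the aperiodic half `ECCellAperiodic d` of every cell
  `(d+1, d)` — in particular of the first open rung `EC(3,2)` — every torus-ruled member meets
  `Γ_exp`**, with no further hypothesis (no rotundity, no multiplicative freeness, no genericity).
* (In `ZilberEacTorusRuledPeriodic.lean`.) **Theorem C** (`…_of_isPeriodVec_last`, the normalised
  periodic half of `EC(3,2)`): if the base has
  the period `e_last` and `ν ∦ e_last`, again `W ∩ Γ_exp ≠ ∅` (either `ν` is not a period — Theorem B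
  — or the base has two independent periods, which together with additive freeness forces a
  DOMINANT additive projection, `hasDominantAddProjection_of_isPeriodVec_of_isPeriodVec_last`).
* (In `ZilberEacTorusRuledPeriodic.lean`.) **Reduction**
  (`inter_expGraph_nonempty_of_isTorusStable_three_two`): for torus-ruled members of
  the whole cell `EC(3,2)` the only configuration left is, in normal form, "base period `e_last`
  and `W` a cylinder in `y_last`" (the piece containing Mantova–Masser's density question for
  exponential points over curve bases); granted that piece, all torus-ruled members of `EC(3,2)`
  meet `Γ_exp`.

Honest framing: a modest STRUCTURAL sub-case of one open cell of Zilber's EAC conjecture (the first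
results of this packet that use the cell structure — irreducibility, additive freeness, the period
dichotomy — rather than explicit fibre shapes); `ECCell 3 2` stays OPEN; rotundity is still not
used; nothing here bears on Schanuel's conjecture, and EAC does not imply SC.

References: Aslanyan–Kirby–Mantova, IMRN 2023, Thm. 1.5 (tree theorem
`aslanyanKirbyMantova2023_thm_1_5_holds`); Mantova–Masser, PLMS 129 (2024) §1 (the open case and the
"simple trick"); Kirby, Algebra & Number Theory 7 (2013) §3 (perfectly rotund varieties).
-/

noncomputable section

open MvPolynomial Matrix
open Literature.NumberTheory.Transcendental Literature.ModelTheory.Zilber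

set_option linter.dupNamespace false

namespace Summit.Schanuel.Schanuel.Theorems

variable {n : ℕ}

/-! ## Theorem A: torus-ruled + dense modulo the ruling direction ⇒ exponential point -/

/-- **Theorem A (torus-ruled varieties, any `n`).** Let `W ⊆ ℂⁿ × ℂⁿ` be irreducible closed with
`V = W ∩ Gⁿ ≠ ∅` additively free and stable under the one-parameter subtorus `y ↦ y · t^ν`
(`ν ≠ 0`), and suppose `π(V) + ℂ·ν` is Zariski dense in `ℂⁿ`. Then `W` meets the graph of `exp`.
Proof: normalise `ν` to `g eᵢ` by a lattice change `Φ_U` (unimodular completion), under which the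
closure becomes a cylinder in `yᵢ` with `π + ℂ eᵢ` dense; swap `xᵢ ↔ yᵢ` and apply
Aslanyan–Kirby–Mantova Thm. 1.5. [cite: AslanyanKirbyMantova2021, Thm. 1.5] -/
theorem inter_expGraph_nonempty_of_isTorusStable {W : Set (Fin n ⊕ Fin n → ℂ)}
    (hW : IsIrreducibleClosed ℂ W) (hne : (W ∩ torusLocus ℂ n).Nonempty)
    (hadd : IsAddFree ℂ n (W ∩ torusLocus ℂ n)) {ν : Fin n → ℤ} (hν : ν ≠ 0)
    (hst : IsTorusStable ν (W ∩ torusLocus ℂ n))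
    (hdense : DenseModDir ℂ ν (projAdd '' (W ∩ torusLocus ℂ n))) :
    (W ∩ expGraph ℂ n).Nonempty := by
  classical
  obtain ⟨g, ν', hg, rfl, hν'⟩ := exists_eq_smul_primitive hν
  obtain ⟨i, -⟩ := Function.ne_iff.1 hν
  obtain ⟨U, V, hUV, hVU, hUν', -⟩ := exists_unimodular_pair_of_primitive hν' i
  have hW' := isIrreducibleClosed_latticeClosure U hW hne
  have hne' := latticeClosure_inter_torusLocus_nonempty U hne
  have hT : latticeClosure U W ∩ torusLocus ℂ n = latticeImage U W :=
    latticeClosure_inter_torusLocus hUV hVU hW.1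
  have hadd' : IsAddFree ℂ n (latticeClosure U W ∩ torusLocus ℂ n) := by
    rw [hT]
    exact isAddFree_latticeImage hUV hadd
  have hUν : U *ᵥ (g • ν') = Pi.single i g := by
    rw [Matrix.mulVec_smul, hUν']
    ext j
    by_cases hj : j = i
    · subst hj; simp
    · simp [Pi.single_eq_of_ne hj]
  have hst' : IsTorusStable (Pi.single i g) (latticeImage (K := ℂ) U W) := by
    rw [← hUν]
    exact isTorusStable_latticeImage U hst
  have hcyl : IsCoordCylinder (latticeClosure U W) (Sum.inr i) := by
    change IsCoordCylinder (zeroLocus ℂ (vanishingIdeal ℂ (latticeImage U W))) (Sum.inr i)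
    exact isCoordCylinder_zeroLocus_vanishingIdeal_of_scale hg
      (fun z hz => latticeImage_subset_torusLocus U W hz i)
      (fun z hz t ht => by rw [← torusScale_single]; exact hst' z hz t ht)
  have hoff : HasDominantAddProjectionOff ℂ i (latticeClosure U W ∩ torusLocus ℂ n) := by
    rw [hT]
    refine hasDominantAddProjectionOff_of_denseModDir_single (g := g) ?_
    rw [projAdd_image_latticeImage, ← hUν]
    exact denseModDir_image_intLinMap hUV hdense
  have h := inter_expGraph_nonempty_of_cylinder_of_off hW' hne' hadd' hcyl hoff
  rwa [latticeClosure_inter_expGraph hUV hVU hW.1, latticeImage_inter_expGraph_nonempty_iff hVU] at h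

/-! ## Theorem B: hypersurface bases — torus-ruled + `ν` not a period ⇒ exponential point -/

/-- **Theorem B (cells `(d+1, d)`).** Let `W ⊆ ℂ^{d+1} × ℂ^{d+1}` be irreducible closed with
additively free torus part `V`, additive projection of closure-dimension `d` (a hypersurface base),
torus-ruled in the direction `ν ≠ 0`, and suppose `ν` is NOT a period vector of the base. Then `W`
meets the graph of `exp` (Theorem A; the base is dense modulo `ν` by
`denseModDir_of_not_isPeriodVec`). [cite: AslanyanKirbyMantova2021, Thm. 1.5] -/
theorem inter_expGraph_nonempty_of_isTorusStable_of_not_isPeriodVec {d : ℕ}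
    {W : Set (Fin (d + 1) ⊕ Fin (d + 1) → ℂ)} (hW : IsIrreducibleClosed ℂ W)
    (hadd : IsAddFree ℂ (d + 1) (W ∩ torusLocus ℂ (d + 1))) (hbase : addProjDim ℂ (d + 1) W = d)
    {ν : Fin (d + 1) → ℤ} (hν : ν ≠ 0) (hst : IsTorusStable ν (W ∩ torusLocus ℂ (d + 1)))
    (hper : ¬ IsPeriodVec ℂ (projAdd '' (W ∩ torusLocus ℂ (d + 1))) ν) :
    (W ∩ expGraph ℂ (d + 1)).Nonempty := by
  have hne := inter_torusLocus_nonempty_of_addProjDim_eq hbase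
  exact inter_expGraph_nonempty_of_isTorusStable hW hne hadd hν hst
    (denseModDir_of_not_isPeriodVec (isPrime_vanishingIdeal_projAdd hW hne) hbase hper)

/-- **Aperiodic bases**: an irreducible closed `W ⊆ ℂ^{d+1} × ℂ^{d+1}` with additively free,
torus-ruled torus part and APERIODIC hypersurface base meets the graph of `exp`.
[cite: AslanyanKirbyMantova2021, Thm. 1.5] -/
theorem inter_expGraph_nonempty_of_isTorusStable_of_not_hasIntegerPeriod {d : ℕ}
    {W : Set (Fin (d + 1) ⊕ Fin (d + 1) → ℂ)} (hW : IsIrreducibleClosed ℂ W)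
    (hadd : IsAddFree ℂ (d + 1) (W ∩ torusLocus ℂ (d + 1))) (hbase : addProjDim ℂ (d + 1) W = d)
    {ν : Fin (d + 1) → ℤ} (hν : ν ≠ 0) (hst : IsTorusStable ν (W ∩ torusLocus ℂ (d + 1)))
    (haper : ¬ HasIntegerPeriod ℂ (projAdd '' (W ∩ torusLocus ℂ (d + 1)))) :
    (W ∩ expGraph ℂ (d + 1)).Nonempty :=
  inter_expGraph_nonempty_of_isTorusStable_of_not_isPeriodVec hW hadd hbase hν hst
    fun h => haper ⟨ν, hν, h⟩

/-- **The aperiodic half of every cell `(d+1, d)` holds for torus-ruled varieties**: with the binders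
of `ECCellAperiodic d` (of which only irreducibility, additive freeness, `addProjDim = d` and
aperiodicity are used), every `W` whose torus part is stable under some one-parameter subtorus
`y ↦ y · t^ν` meets `Γ_exp`.  For `d = 2` this is a structural sub-case of the first open rung
`EC(3,2)`. [cite: AslanyanKirbyMantova2021, Thm. 1.5] -/
theorem ecCellAperiodic_of_isTorusStable (d : ℕ) :
    ∀ (W : Set (Fin (d + 1) ⊕ Fin (d + 1) → ℂ)), IsIrreducibleClosed ℂ W →
      (W ∩ torusLocus ℂ (d + 1)).Nonempty → IsAddFree ℂ (d + 1) (W ∩ torusLocus ℂ (d + 1)) →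
      IsMulFree ℂ (d + 1) (W ∩ torusLocus ℂ (d + 1)) → zariskiDim ℂ W = (d + 1 : ℕ) →
      addProjDim ℂ (d + 1) W = d → ¬ HasIntegerPeriod ℂ (projAdd '' (W ∩ torusLocus ℂ (d + 1))) →
      (∃ ν : Fin (d + 1) → ℤ, ν ≠ 0 ∧ IsTorusStable ν (W ∩ torusLocus ℂ (d + 1))) →
      (W ∩ expGraph ℂ (d + 1)).Nonempty :=
  fun _ hW _ hadd _ _ hbase haper ⟨_, hν, hst⟩ =>
    inter_expGraph_nonempty_of_isTorusStable_of_not_hasIntegerPeriod hW hadd hbase hν hst haper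

/-- The minimal form over an aperiodic base: irreducible closed, additive projection of
closure-dimension `d` (`d ≥ 1`), aperiodic base, torus-ruled — additive freeness is automatic
(`isAddFree_of_not_hasIntegerPeriod`). [cite: AslanyanKirbyMantova2021, Thm. 1.5] -/
theorem inter_expGraph_nonempty_of_isTorusStable_aperiodic {d : ℕ} (hd : 0 < d)
    {W : Set (Fin (d + 1) ⊕ Fin (d + 1) → ℂ)} (hW : IsIrreducibleClosed ℂ W)
    (hbase : addProjDim ℂ (d + 1) W = d)
    (haper : ¬ HasIntegerPeriod ℂ (projAdd '' (W ∩ torusLocus ℂ (d + 1))))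
    {ν : Fin (d + 1) → ℤ} (hν : ν ≠ 0) (hst : IsTorusStable ν (W ∩ torusLocus ℂ (d + 1))) :
    (W ∩ expGraph ℂ (d + 1)).Nonempty :=
  inter_expGraph_nonempty_of_isTorusStable_of_not_hasIntegerPeriod hW
    (isAddFree_of_not_hasIntegerPeriod hW (inter_torusLocus_nonempty_of_addProjDim_eq hbase) hd hbase
      haper) hbase hν hst haper

end Summit.Schanuel.Schanuel.Theorems
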